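import Mathlib
import Literature.Geometry.DiscreteGeometry.KissingNodeDegree

/-!
# Crux `GappedShellCensus.FiveFoldRationingR` (stmt-AtomisticToContinuum-18071), line `Sketch` —
# helper for stub `stub_ffrCensus5` (Aux1 = registered sub-goal `stub_ffrC5Interior`): the centre
# is interior to the radial hull when all shell-degrees are at least four

For a gapped twelve-shell `t : Fin 12 → ℝ³` (norms in `[0.98, 1.02]`, pairwise distances
`≥ 0.98` and either `≤ 1.02` — a bond — or `≥ 1.26`) in which every shell point has AT LEAST four
bonded shell neighbours (the torn-free case of the capped census: degrees `4` or `5`), the centre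
`0` is an interior point of the convex hull of the radially normalised shell `X = {t k / ‖t k‖}`.
This is the standing hypothesis `0 ∈ interior (convexHull ℝ X)` of the tree's hull / fan machinery
for finite sets of unit vectors (`card_fanTriSets`, `sum_triAngleAt`,
`card_filter_fanTriSets_eq_two_of_mem_hullEdges`), used by the icosahedron kill (Aux2) and by the
fan dictionary of the capped census.

Adapted from the sibling crux's `stub_originInterior`
(`GappedShellCensusShellTrichotomyStubOriginInterior.lean`, all degrees EXACTLY four): the proof
only ever uses four of the bonded neighbours of a shell point, so it goes through verbatim after
choosing a four-element subset of the bonded neighbours.  The dictionary lemmas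
(`ffrC5_inner_normalize_le`, `ffrC5_le_inner_normalize`, `ffrC5_norm_normalize`,
`ffrC5_normalize_injective`) are exported for the later helpers.

## Proof

* Dictionary: for radii in `[0.98, 1.02]`, two shell directions make an angle with cosine
  `≤ 2801/5202 ≈ 0.5385` whenever the points are `≥ 0.98` apart, and with cosine
  `≥ 2201/4802 ≈ 0.4584` when moreover they are bonded (`≤ 1.02` apart).
* Hemisphere lemma (`ffrC5_exists_inner_pos`): every open hemisphere contains a normalised shell
  point.  Otherwise some unit `w` has `⟪w, u k⟫ ≤ 0` for all `k`; at an index `k₀` maximising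
  `⟪w, u k⟫` four bonded neighbours `p i` of `v = u k₀` satisfy `⟪w, p i⟫ ≤ ⟪w, v⟫`, which forces
  their tangential components at `v` into a closed tangent half-plane; there the four tangent
  directions have arguments `θ i ∈ [0, π]` pairwise more than `π / 3` apart — impossible.
* Conclusion: the hemisphere lemma gives `affineSpan = ⊤`, hence a nonempty interior of the hull,
  and a functional separating `0` from that interior (`geometric_hahn_banach_open_point`) would be
  `≤ 0` on every shell direction.
-/

noncomputable section

namespace Summit.AtomisticToContinuum.Crystallization.Theorems

open scoped RealInnerProductSpace
open Real
open Literature.Geometry.DiscreteGeometry (inner_eq_sum_three)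

/-! ### Four directions in a closed half-plane -/

/-- Four reals in `[0, π]`, pairwise more than `π / 3` apart, do not exist (sort them: the three
consecutive gaps add up to more than `π`). [folklore] -/
theorem ffrC5_four_angles_false (θ : Fin 4 → ℝ) (h0 : ∀ i, 0 ≤ θ i) (hπ : ∀ i, θ i ≤ π)
    (hsep : ∀ i j, i ≠ j → π / 3 < |θ i - θ j|) : False := by
  -- adapted from (verbatim) `four_angles_false` of the sibling crux's
  -- `GappedShellCensusShellTrichotomyStubOriginInterior.lean`; likewise the next five lemmas
  have hinj : Function.Injective θ := by
    intro i j hij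
    by_contra hne
    have h := hsep i j hne
    rw [hij, sub_self, abs_zero] at h
    linarith [pi_pos]
  have hcard : (Finset.univ.image θ).card = 4 := by
    rw [Finset.card_image_of_injective _ hinj, Finset.card_univ, Fintype.card_fin]
  set e := (Finset.univ.image θ).orderEmbOfFin hcard with he
  have hmem : ∀ k, ∃ i, θ i = e k := by
    intro k
    have h := (Finset.univ.image θ).orderEmbOfFin_mem hcard k
    rw [Finset.mem_image] at h
    obtain ⟨i, -, hi⟩ := h
    exact ⟨i, hi⟩
  choose g hg using hmem
  have hgap : ∀ k l : Fin 4, k < l → π / 3 < e l - e k := by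
    intro k l hkl
    have hlt : e k < e l := e.strictMono hkl
    have hne : g l ≠ g k := by
      intro h
      have h' : e l = e k := by rw [← hg k, ← hg l, h]
      exact hlt.ne' h'
    have h := hsep (g l) (g k) hne
    rwa [hg l, hg k, abs_of_pos (sub_pos.2 hlt)] at h
  have h01 := hgap 0 1 (by decide)
  have h12 := hgap 1 2 (by decide)
  have h23 := hgap 2 3 (by decide)
  have hlo : 0 ≤ e 0 := by rw [← hg 0]; exact h0 _
  have hhi : e 3 ≤ π := by rw [← hg 3]; exact hπ _
  linarith

/-! ### Tangent coordinates at a unit vector -/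

/-- An orthonormal basis of `ℝ³` with prescribed (orthonormal) second and third vectors. [folklore] -/
theorem ffrC5_exists_orthonormalBasis_eq {f v : EuclideanSpace ℝ (Fin 3)} (hf : ‖f‖ = 1)
    (hv : ‖v‖ = 1) (hfv : ⟪f, v⟫ = 0) :
    ∃ b : OrthonormalBasis (Fin 3) ℝ (EuclideanSpace ℝ (Fin 3)), b 1 = f ∧ b 2 = v := by
  have hcard : Module.finrank ℝ (EuclideanSpace ℝ (Fin 3)) = Fintype.card (Fin 3) := by
    rw [finrank_euclideanSpace_fin, Fintype.card_fin]
  have hon : Orthonormal ℝ (({1, 2} : Set (Fin 3)).restrict ![v, f, v]) := by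
    rw [orthonormal_iff_ite]
    rintro ⟨i, hi⟩ ⟨j, hj⟩
    simp only [Set.mem_insert_iff, Set.mem_singleton_iff] at hi hj
    have hvf : ⟪v, f⟫ = 0 := by rw [real_inner_comm, hfv]
    rcases hi with rfl | rfl <;> rcases hj with rfl | rfl <;>
      simp [hf, hv, hvf, hfv]
  obtain ⟨b, hb⟩ := Orthonormal.exists_orthonormalBasis_extension_of_card_eq hcard hon
  exact ⟨b, by simpa using hb 1 (by simp), by simpa using hb 2 (by simp)⟩

/-- **Four bonded neighbours do not fit under a supporting direction.**  Let `v, w` be unit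
vectors with `⟪w, v⟫ ≤ 0` and let `p₀, …, p₃` be unit vectors with `⟪v, p i⟫ ∈ [2201/4802,
2801/5202]`, pairwise `⟪p i, p j⟫ ≤ 2801/5202`, and `⟪w, p i⟫ ≤ ⟪w, v⟫`.  This is impossible:
the tangential parts of the `p i` at `v` lie in a closed half-plane of the tangent plane and are
pairwise more than `π / 3` apart in angle. [folklore] -/
theorem ffrC5_tangent_quadruple_false {v w : EuclideanSpace ℝ (Fin 3)}
    {p : Fin 4 → EuclideanSpace ℝ (Fin 3)} (hv : ‖v‖ = 1) (hw : ‖w‖ = 1) (hm : ⟪w, v⟫ ≤ 0)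
    (hp : ∀ i, ‖p i‖ = 1)
    (hc : ∀ i, (2201 : ℝ) / 4802 ≤ ⟪v, p i⟫ ∧ ⟪v, p i⟫ ≤ 2801 / 5202)
    (hwp : ∀ i, ⟪w, p i⟫ ≤ ⟪w, v⟫) (hpp : ∀ i j, i ≠ j → ⟪p i, p j⟫ ≤ 2801 / 5202) :
    False := by
  -- the tangential part of `w` at `v`
  have hwTv : ⟪w - ⟪w, v⟫ • v, v⟫ = 0 := by
    rw [inner_sub_left, real_inner_smul_left, real_inner_self_eq_norm_sq, hv]; ring
  by_cases hT : w - ⟪w, v⟫ • v = 0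
  · -- `w = ⟪w, v⟫ • v` is a unit vector with `⟪w, v⟫ ≤ 0`, so `w = -v`, and `p 0 = v`?!
    have hwm : w = ⟪w, v⟫ • v := (sub_eq_zero.1 hT)
    have habs : |⟪w, v⟫| = 1 := by
      have h := congrArg (fun z => ‖z‖) hwm
      simp only [norm_smul, Real.norm_eq_abs, hv, hw, mul_one] at h
      exact h.symm
    have hm1 : ⟪w, v⟫ = -1 := by
      rcases (abs_eq zero_le_one).1 habs with h | h
      · linarith
      · exact h
    have h0 := hwp 0
    rw [hwm, real_inner_smul_left, real_inner_smul_left, real_inner_self_eq_norm_sq, hv,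
      hm1] at h0
    linarith [(hc 0).2]
  · -- tangent frame `(b 0, b 1, v)` with `b 1 = f` opposite to the tangential part of `w`
    have hσ : 0 < ‖w - ⟪w, v⟫ • v‖ := norm_pos_iff.2 hT
    set f : EuclideanSpace ℝ (Fin 3) := (-‖w - ⟪w, v⟫ • v‖⁻¹) • (w - ⟪w, v⟫ • v) with hfdef
    have hf : ‖f‖ = 1 := by
      rw [hfdef, norm_smul, norm_neg, norm_inv, norm_norm, inv_mul_cancel₀ hσ.ne']
    have hfv : ⟪f, v⟫ = 0 := by rw [hfdef, real_inner_smul_left, hwTv, mul_zero]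
    obtain ⟨b, hb1, hb2⟩ := ffrC5_exists_orthonormalBasis_eq hf hv hfv
    -- coordinates `x i = ⟪b 0, p i⟫`, `y i = ⟪b 1, p i⟫ ≥ 0`, `⟪b 2, p i⟫ = ⟪v, p i⟫`
    have hy : ∀ i, 0 ≤ ⟪b 1, p i⟫ := by
      intro i
      have h1 : ⟪w, p i⟫ - ⟪w, v⟫ * ⟪v, p i⟫ ≤ 0 := by nlinarith [hwp i, (hc i).2, hm]
      have h2 : ⟪b 1, p i⟫ = -‖w - ⟪w, v⟫ • v‖⁻¹ * (⟪w, p i⟫ - ⟪w, v⟫ * ⟪v, p i⟫) := by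
        rw [hb1, hfdef, real_inner_smul_left, inner_sub_left, real_inner_smul_left]
      rw [h2, neg_mul, neg_nonneg]
      exact mul_nonpos_iff.2 (Or.inl ⟨inv_nonneg.2 (norm_nonneg _), h1⟩)
    have hsq : ∀ i, ⟪b 0, p i⟫ ^ 2 + ⟪b 1, p i⟫ ^ 2 = 1 - ⟪v, p i⟫ ^ 2 := by
      intro i
      have h1 : ⟪p i, p i⟫ = 1 := by rw [real_inner_self_eq_norm_sq, hp i, one_pow]
      rw [inner_eq_sum_three b, hb2] at h1
      linear_combination h1
    have hinner : ∀ i j, ⟪p i, p j⟫ =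
        ⟪b 0, p i⟫ * ⟪b 0, p j⟫ + ⟪b 1, p i⟫ * ⟪b 1, p j⟫ + ⟪v, p i⟫ * ⟪v, p j⟫ := by
      intro i j
      rw [inner_eq_sum_three b, hb2]
    -- polar form of the tangential parts
    set z : Fin 4 → ℂ := fun i => ⟨⟪b 0, p i⟫, ⟪b 1, p i⟫⟩ with hzdef
    set θ : Fin 4 → ℝ := fun i => Complex.arg (z i) with hθdef
    have hzx : ∀ i, ⟪b 0, p i⟫ = ‖z i‖ * cos (θ i) := fun i =>
      (Complex.norm_mul_cos_arg (z i)).symm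
    have hzy : ∀ i, ⟪b 1, p i⟫ = ‖z i‖ * sin (θ i) := fun i =>
      (Complex.norm_mul_sin_arg (z i)).symm
    have hzn : ∀ i, ‖z i‖ ^ 2 = 1 - ⟪v, p i⟫ ^ 2 := by
      intro i
      rw [Complex.sq_norm, hzdef, Complex.normSq_mk, ← hsq i]
      ring
    have hθ0 : ∀ i, 0 ≤ θ i := fun i => Complex.arg_nonneg_iff.2 (hy i)
    have hθπ : ∀ i, θ i ≤ π := fun i => Complex.arg_le_pi _
    refine ffrC5_four_angles_false θ hθ0 hθπ fun i j hij => ?_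
    by_contra hle
    push Not at hle
    -- two tangent directions within `π / 3` of each other
    have hcos : 1 / 2 ≤ cos (θ i - θ j) := by
      rw [← cos_pi_div_three, ← cos_abs (θ i - θ j)]
      exact cos_le_cos_of_nonneg_of_le_pi (abs_nonneg _) (by linarith [pi_pos]) hle
    have hQ : ⟪b 0, p i⟫ * ⟪b 0, p j⟫ + ⟪b 1, p i⟫ * ⟪b 1, p j⟫ =
        ‖z i‖ * ‖z j‖ * cos (θ i - θ j) := by
      rw [cos_sub]
      linear_combination ⟪b 0, p j⟫ * hzx i + ‖z i‖ * cos (θ i) * hzx j +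
        ⟪b 1, p j⟫ * hzy i + ‖z i‖ * sin (θ i) * hzy j
    have hcc : ((2201 : ℝ) / 4802) ^ 2 ≤ ⟪v, p i⟫ * ⟪v, p j⟫ := by
      nlinarith [(hc i).1, (hc j).1]
    have hNN : 1 - ((2801 : ℝ) / 5202) ^ 2 ≤ ‖z i‖ * ‖z j‖ := by
      refine le_of_pow_le_pow_left₀ two_ne_zero (by positivity) ?_
      rw [mul_pow, hzn i, hzn j]
      have hi1 : 1 - ((2801 : ℝ) / 5202) ^ 2 ≤ 1 - ⟪v, p i⟫ ^ 2 := by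
        nlinarith [(hc i).1, (hc i).2]
      have hj1 : 1 - ((2801 : ℝ) / 5202) ^ 2 ≤ 1 - ⟪v, p j⟫ ^ 2 := by
        nlinarith [(hc j).1, (hc j).2]
      rw [sq]
      exact mul_le_mul hi1 hj1 (by norm_num) (by linarith)
    have hhalf : ‖z i‖ * ‖z j‖ * (1 / 2) ≤ ‖z i‖ * ‖z j‖ * cos (θ i - θ j) :=
      mul_le_mul_of_nonneg_left hcos (by positivity)
    have h := hpp i j hij
    rw [hinner, hQ] at h
    linarith

/-! ### The dictionary: angles between shell directions -/

/-- The cosine of the angle between two shell directions, in terms of the points. [folklore] -/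
theorem ffrC5_inner_normalize (a c : EuclideanSpace ℝ (Fin 3)) (ha : 0 < ‖a‖) (hc : 0 < ‖c‖) :
    ⟪‖a‖⁻¹ • a, ‖c‖⁻¹ • c⟫ = ⟪a, c⟫ / (‖a‖ * ‖c‖) := by
  rw [real_inner_smul_left, real_inner_smul_right]
  field_simp

/-- Two shell points at distance `≥ 0.98` subtend an angle with cosine `≤ 2801/5202` (the value
for radii `1.02, 1.02` and distance `0.98`). [folklore] -/
theorem ffrC5_inner_normalize_le {a c : EuclideanSpace ℝ (Fin 3)}
    (ha : 1 - 1 / 50 ≤ ‖a‖ ∧ ‖a‖ ≤ 1 + 1 / 50) (hc : 1 - 1 / 50 ≤ ‖c‖ ∧ ‖c‖ ≤ 1 + 1 / 50)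
    (hd : 1 - 1 / 50 ≤ dist a c) : ⟪‖a‖⁻¹ • a, ‖c‖⁻¹ • c⟫ ≤ 2801 / 5202 := by
  have ha0 : 0 < ‖a‖ := by linarith [ha.1]
  have hc0 : 0 < ‖c‖ := by linarith [hc.1]
  rw [ffrC5_inner_normalize a c ha0 hc0, div_le_iff₀ (mul_pos ha0 hc0)]
  have h := norm_sub_sq_real a c
  rw [← dist_eq_norm] at h
  have hd2 : (1 - 1 / 50 : ℝ) ^ 2 ≤ dist a c ^ 2 := pow_le_pow_left₀ (by norm_num) hd 2
  nlinarith [mul_nonneg (sub_nonneg.2 ha.1) (sub_nonneg.2 ha.2),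
    mul_nonneg (sub_nonneg.2 hc.1) (sub_nonneg.2 hc.2),
    mul_nonneg (sub_nonneg.2 ha.2) (sub_nonneg.2 hc.2)]

/-- Two BONDED shell points (distance `≤ 1.02`) subtend an angle with cosine `≥ 2201/4802` (the
value for radii `0.98, 0.98` and distance `1.02`). [folklore] -/
theorem ffrC5_le_inner_normalize {a c : EuclideanSpace ℝ (Fin 3)}
    (ha : 1 - 1 / 50 ≤ ‖a‖ ∧ ‖a‖ ≤ 1 + 1 / 50) (hc : 1 - 1 / 50 ≤ ‖c‖ ∧ ‖c‖ ≤ 1 + 1 / 50)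
    (hd : dist a c ≤ 1 + 1 / 50) : 2201 / 4802 ≤ ⟪‖a‖⁻¹ • a, ‖c‖⁻¹ • c⟫ := by
  have ha0 : 0 < ‖a‖ := by linarith [ha.1]
  have hc0 : 0 < ‖c‖ := by linarith [hc.1]
  rw [ffrC5_inner_normalize a c ha0 hc0, le_div_iff₀ (mul_pos ha0 hc0)]
  have h := norm_sub_sq_real a c
  rw [← dist_eq_norm] at h
  have hd2 : dist a c ^ 2 ≤ (1 + 1 / 50 : ℝ) ^ 2 := pow_le_pow_left₀ dist_nonneg hd 2
  nlinarith [mul_nonneg (sub_nonneg.2 ha.1) (sub_nonneg.2 hc.1), sq_nonneg (‖a‖ - ‖c‖)]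

/-- A normalised shell point is a unit vector. [folklore] -/
theorem ffrC5_norm_normalize {a : EuclideanSpace ℝ (Fin 3)} (ha : 1 - 1 / 50 ≤ ‖a‖ ∧ ‖a‖ ≤ 1 + 1 / 50) :
    ‖‖a‖⁻¹ • a‖ = 1 := by
  have ha0 : 0 < ‖a‖ := by linarith [ha.1]
  rw [norm_smul, norm_inv, norm_norm, inv_mul_cancel₀ ha0.ne']

/-- Two shell points at distance `≥ 0.98` have distinct directions. [folklore] -/
theorem ffrC5_normalize_ne {a c : EuclideanSpace ℝ (Fin 3)}
    (ha : 1 - 1 / 50 ≤ ‖a‖ ∧ ‖a‖ ≤ 1 + 1 / 50) (hc : 1 - 1 / 50 ≤ ‖c‖ ∧ ‖c‖ ≤ 1 + 1 / 50)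
    (hd : 1 - 1 / 50 ≤ dist a c) : ‖a‖⁻¹ • a ≠ ‖c‖⁻¹ • c := by
  intro h
  have h1 := ffrC5_inner_normalize_le ha hc hd
  rw [h, real_inner_self_eq_norm_sq, ffrC5_norm_normalize hc] at h1
  norm_num at h1

/-- The radial normalisation of a gapped shell tuple is injective. [folklore] -/
theorem ffrC5_normalize_injective (t : Fin 12 → EuclideanSpace ℝ (Fin 3))
    (hn : ∀ k, 1 - 1 / 50 ≤ ‖t k‖ ∧ ‖t k‖ ≤ 1 + 1 / 50)
    (hd : ∀ k l, k ≠ l → 1 - 1 / 50 ≤ dist (t k) (t l) ∧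
      (dist (t k) (t l) ≤ 1 + 1 / 50 ∨ 63 / 50 ≤ dist (t k) (t l))) :
    Function.Injective fun k => ‖t k‖⁻¹ • t k := by
  intro k l hkl
  by_contra hne
  exact ffrC5_normalize_ne (hn k) (hn l) (hd k l hne).1 hkl

/-! ### The hemisphere lemma -/

/-- **Every open hemisphere contains a normalised shell point** when all shell-degrees are at
least four: for `w ≠ 0` some `k` has `0 < ⟪w, t k / ‖t k‖⟫`. [folklore] -/
theorem ffrC5_exists_inner_pos (t : Fin 12 → EuclideanSpace ℝ (Fin 3))
    (hn : ∀ k, 1 - 1 / 50 ≤ ‖t k‖ ∧ ‖t k‖ ≤ 1 + 1 / 50)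
    (hd : ∀ k l, k ≠ l → 1 - 1 / 50 ≤ dist (t k) (t l) ∧
      (dist (t k) (t l) ≤ 1 + 1 / 50 ∨ 63 / 50 ≤ dist (t k) (t l)))
    (h4 : ∀ k, 4 ≤ (Finset.univ.filter fun l => l ≠ k ∧ dist (t k) (t l) ≤ 1 + 1 / 50).card)
    {w : EuclideanSpace ℝ (Fin 3)} (hw : w ≠ 0) : ∃ k, 0 < ⟪w, ‖t k‖⁻¹ • t k⟫ := by
  -- adapted from `exists_inner_pos` of the sibling crux's
  -- `GappedShellCensusShellTrichotomyStubOriginInterior.lean` (degrees exactly four)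
  by_contra hcon
  push Not at hcon
  set u : Fin 12 → EuclideanSpace ℝ (Fin 3) := fun k => ‖t k‖⁻¹ • t k with hudef
  have hu : ∀ k, ‖u k‖ = 1 := by
    intro k
    have hk : 0 < ‖t k‖ := by linarith [(hn k).1]
    rw [hudef, norm_smul, norm_inv, norm_norm, inv_mul_cancel₀ hk.ne']
  have hhi : ∀ k l, k ≠ l → ⟪u k, u l⟫ ≤ 2801 / 5202 := fun k l hkl =>
    ffrC5_inner_normalize_le (hn k) (hn l) (hd k l hkl).1
  have hlo : ∀ k l, dist (t k) (t l) ≤ 1 + 1 / 50 → 2201 / 4802 ≤ ⟪u k, u l⟫ := fun k l hkl =>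
    ffrC5_le_inner_normalize (hn k) (hn l) hkl
  -- normalise `w` and pick the shell direction closest to the boundary of the hemisphere
  set w₁ : EuclideanSpace ℝ (Fin 3) := ‖w‖⁻¹ • w with hw₁def
  have hw₁ : ‖w₁‖ = 1 := by
    rw [hw₁def, norm_smul, norm_inv, norm_norm, inv_mul_cancel₀ (norm_ne_zero_iff.2 hw)]
  have hw₁u : ∀ k, ⟪w₁, u k⟫ ≤ 0 := fun k => by
    rw [hw₁def, real_inner_smul_left]
    exact mul_nonpos_iff.2 (Or.inl ⟨inv_nonneg.2 (norm_nonneg w), hcon k⟩)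
  obtain ⟨k₀, -, hk₀⟩ :=
    Finset.exists_max_image Finset.univ (fun k => ⟪w₁, u k⟫) Finset.univ_nonempty
  -- four of its bonded neighbours
  obtain ⟨N, hNsub, hNc⟩ := Finset.exists_subset_card_eq (h4 k₀)
  set e := N.orderEmbOfFin hNc with hedef
  have he : ∀ i, e i ≠ k₀ ∧ dist (t k₀) (t (e i)) ≤ 1 + 1 / 50 := fun i =>
    (Finset.mem_filter.1 (hNsub (Finset.orderEmbOfFin_mem _ hNc i))).2
  refine ffrC5_tangent_quadruple_false (v := u k₀) (w := w₁) (p := fun i => u (e i)) (hu k₀) hw₁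
    (hw₁u k₀) (fun i => hu _) (fun i => ⟨hlo _ _ (he i).2, hhi _ _ (he i).1.symm⟩)
    (fun i => hk₀ (e i) (Finset.mem_univ _)) fun i j hij => hhi _ _ fun h => hij (e.injective h)

/-! ### The centre is interior (registered sub-goal `stub_ffrC5Interior` of `stub_ffrCensus5`) -/

/-- **All shell-degrees at least four ⇒ the centre is interior to the hull of the radial
projection.**  For a gapped twelve-shell `t` (norms in `[0.98, 1.02]`, pairwise distances `≥ 0.98`
and either `≤ 1.02` or `≥ 1.26`) in which every shell point has at least four shell points within
`1.02`, `0 ∈ interior (convexHull ℝ {t k / ‖t k‖})`.  By the hemisphere lemma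
`ffrC5_exists_inner_pos` the normalised shell meets every open hemisphere; hence it is affinely
spanning, its hull has an interior point, and a functional separating `0` from that interior
(`geometric_hahn_banach_open_point`) would be nonpositive on the whole shell — the pattern of
`IsTammesOptimal.zero_mem_interior_convexHull`. [folklore] -/
theorem stub_ffrC5Interior :
    ∀ t : Fin 12 → EuclideanSpace ℝ (Fin 3),
        (∀ k, 1 - 1 / 50 ≤ ‖t k‖ ∧ ‖t k‖ ≤ 1 + 1 / 50) →
        (∀ k l, k ≠ l → 1 - 1 / 50 ≤ dist (t k) (t l) ∧ (dist (t k) (t l) ≤ 1 + 1 / 50 ∨ 63 / 50 ≤ dist (t k) (t l))) →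
        (∀ k, 4 ≤ (Finset.univ.filter fun l => l ≠ k ∧ dist (t k) (t l) ≤ 1 + 1 / 50).card) →
        (0 : EuclideanSpace ℝ (Fin 3)) ∈ interior (convexHull ℝ (Set.range fun k => ‖t k‖⁻¹ • t k)) := by
  -- adapted from `stub_originInterior` (sibling crux ShellTrichotomy, degrees exactly four)
  intro t hn hd h4
  set u : Fin 12 → EuclideanSpace ℝ (Fin 3) := fun k => ‖t k‖⁻¹ • t k with hudef
  have hpos : ∀ w : EuclideanSpace ℝ (Fin 3), w ≠ 0 → ∃ k, 0 < ⟪w, u k⟫ := fun w hw =>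
    ffrC5_exists_inner_pos t hn hd h4 hw
  -- the normalised shell is affinely spanning
  have haff : affineSpan ℝ (Set.range u) = ⊤ := by
    have hne : (affineSpan ℝ (Set.range u) : Set (EuclideanSpace ℝ (Fin 3))).Nonempty :=
      ⟨u 0, mem_affineSpan ℝ ⟨0, rfl⟩⟩
    rw [← AffineSubspace.direction_eq_top_iff_of_nonempty hne, ← Submodule.orthogonal_eq_bot_iff]
    by_contra hbot
    obtain ⟨v, hv, hv0⟩ := Submodule.exists_mem_ne_zero_of_ne_bot hbot
    have hconst : ∀ j, ⟪v, u j⟫ = ⟪v, u 0⟫ := by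
      intro j
      have hmem : u j -ᵥ u 0 ∈ (affineSpan ℝ (Set.range u)).direction :=
        AffineSubspace.vsub_mem_direction (mem_affineSpan ℝ ⟨j, rfl⟩)
          (mem_affineSpan ℝ ⟨0, rfl⟩)
      have h0 : ⟪v, u j -ᵥ u 0⟫ = 0 := by
        rw [real_inner_comm]
        exact (Submodule.mem_orthogonal _ v).1 hv _ hmem
      rwa [vsub_eq_sub, inner_sub_right, sub_eq_zero] at h0
    rcases le_or_gt 0 ⟪v, u 0⟫ with hc | hc
    · obtain ⟨j, hj⟩ := hpos (-v) (neg_ne_zero.2 hv0)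
      rw [inner_neg_left, hconst j] at hj
      linarith
    · obtain ⟨j, hj⟩ := hpos v hv0
      rw [hconst j] at hj
      linarith
  -- separation
  set C := convexHull ℝ (Set.range u) with hC
  have hCconv : Convex ℝ C := convex_convexHull ℝ _
  have hint : (interior C).Nonempty := interior_convexHull_nonempty_iff_affineSpan_eq_top.2 haff
  by_contra h0
  obtain ⟨f, hf⟩ := geometric_hahn_banach_open_point hCconv.interior isOpen_interior h0
  rw [map_zero] at hf
  have hle : ∀ j, f (u j) ≤ 0 := by
    intro j
    have hxC : u j ∈ closure (interior C) := by
      rw [hCconv.closure_interior_eq_closure_of_nonempty_interior hint]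
      exact subset_closure (subset_convexHull ℝ _ ⟨j, rfl⟩)
    have hclosed : IsClosed {a : EuclideanSpace ℝ (Fin 3) | f a ≤ 0} :=
      isClosed_le f.continuous continuous_const
    exact (hclosed.closure_subset_iff.2 fun a ha => (hf a ha).le) hxC
  set w : EuclideanSpace ℝ (Fin 3) := (InnerProductSpace.toDual ℝ _).symm f with hw
  have hfw : ∀ a, f a = ⟪w, a⟫ := fun a => by rw [hw, InnerProductSpace.toDual_symm_apply]
  have hw0 : w ≠ 0 := by
    intro h
    obtain ⟨q, hq⟩ := hint
    have h' := hf q hq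
    rw [hfw, h, inner_zero_left] at h'
    exact lt_irrefl _ h'
  obtain ⟨j, hj⟩ := hpos w hw0
  have h' := hle j
  rw [hfw] at h'
  linarith

end Summit.AtomisticToContinuum.Crystallization.Theorems
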